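import Mathlib

/-!
# `ConfusionCovering` (crux dir `OrbitDimensionBound`, stmt-ValiantsHypothesis-16133, route FreeSubtorus):
# a GENERIC ELEMENT of an admissibly cut subtorus (the registered stub `stub_genericElement`)

Registered stub 1 of the lines `row_torus` (active skeleton of stmt-ValiantsHypothesis-16133), `confusion_covering`
(rung `ConfusionCovering`) and the floor's `birth` line — shared verbatim by all three.

**Theorem (`stub_genericElement`).**  Let `Λ : Fin r → ([n] ⊔ [n]) → ℤ` have zero ROW-sums.  Then there are
`d, e ∈ (ℂˣ)ⁿ` with (i) the relations `∏_k d_k^{Λ_i(inl k)} ∏_l e_l^{Λ_i(inr l)} = 1`, (ii) no non-negative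
multiplicative relation among the weights `d_k e_l` (`∏_p (d_{p.1} e_{p.2})^{u_p} ≠ 1` for `0 ≠ u ∈ ℕ^{n × n}`), and
(iii) exact separation: a character `χ` with `χ(d, e) = 1` satisfies `N χ ∈ ℤΛ` for some `N ≠ 0`.

**Proof.**  Let `W = span_ℚ(Λ_i) ≤ ℚ^{[n]⊔[n]}`.  Choose an INJECTIVE `ℚ`-linear map
`φ : ℚ^{[n]⊔[n]}/W → ℝ` (a transcendental real `ξ` — a Liouville number — gives `ℚ`-linearly independent powers
`1, ξ, ξ², …`), put `w_x = φ(e_x mod W) ∈ ℝ` and `d_k = exp(w_{inl k})`, `e_l = exp(w_{inr l})` (positive reals).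
A character `χ` evaluates to `exp(Σ_x χ_x w_x) = exp(φ(χ mod W))`, which is `1` iff `Σ χ_x w_x = 0` iff `χ ∈ W`
(injectivity), i.e. iff `χ` is a rational — hence, clearing denominators, `N χ` an integral — combination of the
`Λ_i`.  (i): `Λ_i ∈ W`.  (ii): the character of `u` has row part the row-sums of `u`, of total mass `|u| > 0`,
while every element of `W` has zero total row mass. [cite: LandsbergRessayre2017, §6]
-/

open Finset

-- the mandated summit-side namespace repeats a component by design (single-problem summit)
set_option linter.dupNamespace false

namespace Summit.ValiantsHypothesis.ValiantsHypothesis.Theorems.FreeSubtorusConfusionCovering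

noncomputable section

/-! ### `ℚ`-linearly independent reals and an injective `ℚ`-linear map into `ℝ` -/

/-- The powers `1, ξ, …, ξ^{s-1}` of a real number transcendental over `ℚ` are `ℚ`-linearly independent. [folklore] -/
theorem linearIndependent_pow_of_transcendental {ξ : ℝ} (hξ : Transcendental ℚ ξ) (s : ℕ) :
    LinearIndependent ℚ (fun i : Fin s => ξ ^ (i : ℕ)) := by
  classical
  rw [Fintype.linearIndependent_iff]
  intro g hg i
  have hinj := transcendental_iff_injective.1 hξ
  set p : Polynomial ℚ := ∑ j : Fin s, Polynomial.monomial (j : ℕ) (g j) with hp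
  have hp0 : p = 0 := by
    apply hinj
    rw [map_zero, hp, map_sum]
    simp only [Polynomial.aeval_monomial]
    rw [← hg]
    refine Finset.sum_congr rfl fun j _ => ?_
    rw [Algebra.smul_def]
  have hcoeff : p.coeff (i : ℕ) = g i := by
    rw [hp, Polynomial.finsetSum_coeff]
    simp only [Polynomial.coeff_monomial]
    rw [Finset.sum_eq_single i]
    · rw [if_pos rfl]
    · intro j _ hj; rw [if_neg (fun h => hj (Fin.ext h))]
    · intro h; exact absurd (mem_univ _) h
  rw [← hcoeff, hp0, Polynomial.coeff_zero]

/-- There is a real number transcendental over `ℚ` (a Liouville number). [folklore] -/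
theorem exists_transcendental_real : ∃ ξ : ℝ, Transcendental ℚ ξ := by
  refine ⟨liouvilleNumber ((2 : ℕ) : ℝ), fun h => ?_⟩
  exact (liouville_liouvilleNumber (m := 2) le_rfl).transcendental ((IsFractionRing.isAlgebraic_iff ℤ ℚ ℝ).2 h)

/-- **An injective `ℚ`-linear map into `ℝ`** from any finite-dimensional `ℚ`-vector space (send a basis to
`ℚ`-linearly independent reals). [folklore] -/
theorem exists_injective_ratLinear_real (V : Type*) [AddCommGroup V] [Module ℚ V] [Module.Finite ℚ V] :
    ∃ φ : V →ₗ[ℚ] ℝ, Function.Injective φ := by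
  classical
  obtain ⟨ξ, hξ⟩ := exists_transcendental_real
  set s := Module.finrank ℚ V
  let b : Module.Basis (Fin s) ℚ V := Module.finBasis ℚ V
  have hli := linearIndependent_pow_of_transcendental hξ s
  refine ⟨b.constr ℚ fun i : Fin s => ξ ^ (i : ℕ), ?_⟩
  rw [← LinearMap.ker_eq_bot, eq_bot_iff]
  intro x hx
  rw [LinearMap.mem_ker, Module.Basis.constr_apply_fintype] at hx
  have h0 : ∀ i, b.equivFun x i = 0 := (Fintype.linearIndependent_iff.1 hli) _ hx
  rw [Submodule.mem_bot, b.ext_elem_iff]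
  intro i
  rw [map_zero, Finsupp.zero_apply, ← Module.Basis.equivFun_apply]
  exact h0 i

/-! ### Generic real weights: vanishing sums detect exactly the rational span -/

/-- **Generic real weights.**  For integer vectors `Λ_i` there are real weights `w_x` such that, for every integer
vector `z`, `Σ_x z_x w_x = 0` iff `z` is a rational combination of the `Λ_i`. [folklore] -/
theorem exists_generic_weights {X : Type*} [Fintype X] [DecidableEq X] {r : ℕ} (Λ : Fin r → X → ℤ) :
    ∃ w : X → ℝ, ∀ z : X → ℤ,
      (∑ x, (z x : ℝ) * w x = 0) ↔ ∃ c : Fin r → ℚ, ∀ x, (z x : ℚ) = ∑ i, c i * (Λ i x : ℚ) := by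
  classical
  set ΛQ : Fin r → (X → ℚ) := fun i x => (Λ i x : ℚ) with hΛQ
  set W : Submodule ℚ (X → ℚ) := Submodule.span ℚ (Set.range ΛQ) with hW
  obtain ⟨φ, hφ⟩ := exists_injective_ratLinear_real ((X → ℚ) ⧸ W)
  refine ⟨fun x => φ (W.mkQ (Pi.single x 1)), fun z => ?_⟩
  -- the sum is `φ (z mod W)`
  have hsum : ∑ x, (z x : ℝ) * φ (W.mkQ (Pi.single x 1)) = φ (W.mkQ fun x => (z x : ℚ)) := by
    have hz : (fun x => (z x : ℚ)) = ∑ x, (z x : ℚ) • (Pi.single x (1 : ℚ) : X → ℚ) := by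
      ext y
      simp only [Finset.sum_apply, Pi.smul_apply, Pi.single_apply, smul_eq_mul, mul_ite, mul_one, mul_zero,
        Finset.sum_ite_eq, mem_univ, if_true]
    rw [hz, map_sum, map_sum]
    refine Finset.sum_congr rfl fun x _ => ?_
    rw [map_smul, map_smul, Rat.smul_def, Rat.cast_intCast]
  rw [hsum, map_eq_zero_iff φ hφ, Submodule.mkQ_apply, Submodule.Quotient.mk_eq_zero, hW,
    Submodule.mem_span_range_iff_exists_fun]
  constructor
  · rintro ⟨c, hc⟩
    refine ⟨c, fun x => ?_⟩
    have := congrFun hc x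
    simp only [Finset.sum_apply, Pi.smul_apply, smul_eq_mul] at this
    exact this.symm
  · rintro ⟨c, hc⟩
    refine ⟨c, ?_⟩
    ext x
    simp only [Finset.sum_apply, Pi.smul_apply, smul_eq_mul]
    exact (hc x).symm

/-- Clearing denominators: a rational combination of integer vectors is, after scaling by `N ≠ 0`, an integral
combination. [folklore] -/
theorem exists_int_combination {X : Type*} {r : ℕ} (Λ : Fin r → X → ℤ) (χ : X → ℤ) (c : Fin r → ℚ)
    (h : ∀ x, (χ x : ℚ) = ∑ i, c i * (Λ i x : ℚ)) :
    ∃ (N : ℤ) (a : Fin r → ℤ), N ≠ 0 ∧ N • χ = ∑ i, a i • Λ i := by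
  classical
  set D : ℕ := ∏ i, (c i).den with hD
  have hDpos : 0 < D := Finset.prod_pos fun i _ => (c i).den_pos
  have hdvd : ∀ i, (c i).den ∣ D := fun i => Finset.dvd_prod_of_mem _ (mem_univ i)
  refine ⟨D, fun i => (D / (c i).den : ℕ) * (c i).num, by exact_mod_cast hDpos.ne', ?_⟩
  have ha : ∀ i, ((D / (c i).den : ℕ) : ℚ) * ((c i).num : ℚ) = (D : ℚ) * c i := by
    intro i
    have h1 : ((D / (c i).den : ℕ) : ℚ) * ((c i).den : ℚ) = (D : ℚ) := by
      rw [← Nat.cast_mul, Nat.div_mul_cancel (hdvd i)]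
    rw [← h1, mul_assoc, mul_comm ((c i).den : ℚ) (c i), Rat.mul_den_eq_num]
  funext x
  apply Int.cast_injective (α := ℚ)
  simp only [Pi.smul_apply, Finset.sum_apply, smul_eq_mul, Int.cast_mul, Int.cast_sum, Int.cast_natCast]
  rw [h x, Finset.mul_sum]
  refine Finset.sum_congr rfl fun i _ => ?_
  rw [← mul_assoc, ← ha i]

/-! ### Characters of exponential weights -/

/-- A character evaluated at units `d_k = exp(t_k)` (`t_k` real): `∏_k d_k^{z_k} = exp(Σ_k z_k t_k)`. [folklore] -/
theorem units_prod_zpow_eq_exp {ι : Type*} [Fintype ι] (d : ι → ℂˣ) (t : ι → ℝ)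
    (hd : ∀ k, (d k : ℂ) = Complex.exp (t k)) (z : ι → ℤ) :
    ((∏ k, d k ^ z k : ℂˣ) : ℂ) = Complex.exp ((∑ k, (z k : ℝ) * t k : ℝ) : ℂ) := by
  rw [Units.coe_prod, Complex.ofReal_sum, Complex.exp_sum]
  refine Finset.prod_congr rfl fun k _ => ?_
  rw [Units.val_zpow_eq_zpow_val, hd, Complex.ofReal_mul, Complex.ofReal_intCast, Complex.exp_int_mul]

/-- Powers of products of exponential weights: `∏_p (exp a_p)^{u_p} = exp(Σ_p u_p a_p)`. [folklore] -/
theorem prod_pow_eq_exp {ι : Type*} [Fintype ι] (a : ι → ℂ) (t : ι → ℝ) (ha : ∀ p, a p = Complex.exp (t p))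
    (u : ι → ℕ) : ∏ p, a p ^ u p = Complex.exp ((∑ p, (u p : ℝ) * t p : ℝ) : ℂ) := by
  rw [Complex.ofReal_sum, Complex.exp_sum]
  refine Finset.prod_congr rfl fun p _ => ?_
  rw [ha, Complex.ofReal_mul, Complex.ofReal_natCast, Complex.exp_nat_mul]

/-- `exp` of a real number is `1` iff the number is `0`. [folklore] -/
theorem exp_ofReal_eq_one_iff (S : ℝ) : Complex.exp (S : ℂ) = 1 ↔ S = 0 := by
  rw [← Complex.ofReal_exp, Complex.ofReal_eq_one, Real.exp_eq_one_iff]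

/-! ### The stub -/

/-- **Generic element of an admissibly cut subtorus (registered stub `stub_genericElement`).**  For `Λ` with zero
row-sums there are `d, e ∈ (ℂˣ)ⁿ` satisfying the relations of `T_Λ`, admitting no non-negative multiplicative relation
among the weights `d_k e_l`, and separating characters exactly modulo the saturation of `ℤΛ`.  Construction:
`d_k = exp(w_{inl k})`, `e_l = exp(w_{inr l})` for generic real weights `w` (module docstring).
[cite: LandsbergRessayre2017, §6] -/
theorem stub_genericElement :
    ∀ (n r : ℕ) (Λ : Fin r → (Fin n ⊕ Fin n) → ℤ),
    (∀ i, (∑ k, Λ i (Sum.inl k)) = 0) →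
    ∃ d e : Fin n → ℂˣ,
      (∀ i, (∏ k, (d k) ^ (Λ i (Sum.inl k))) * (∏ l, (e l) ^ (Λ i (Sum.inr l))) = 1) ∧
      (∀ u : Fin n × Fin n → ℕ, u ≠ 0 → (∏ p, ((d p.1 : ℂ) * (e p.2 : ℂ)) ^ (u p)) ≠ 1) ∧
      (∀ χ : (Fin n ⊕ Fin n) → ℤ,
        (∏ k, (d k) ^ (χ (Sum.inl k))) * (∏ l, (e l) ^ (χ (Sum.inr l))) = 1 →
        ∃ (N : ℤ) (a : Fin r → ℤ), N ≠ 0 ∧ N • χ = ∑ i, a i • Λ i) := by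
  intro n r Λ hrow
  classical
  obtain ⟨w, hw⟩ := exists_generic_weights Λ
  -- the element
  set d : Fin n → ℂˣ := fun k => Units.mk0 (Complex.exp (w (Sum.inl k) : ℂ)) (Complex.exp_ne_zero _) with hd
  set e : Fin n → ℂˣ := fun l => Units.mk0 (Complex.exp (w (Sum.inr l) : ℂ)) (Complex.exp_ne_zero _) with he
  have hdval : ∀ k, (d k : ℂ) = Complex.exp (w (Sum.inl k) : ℂ) := fun k => rfl
  have heval : ∀ l, (e l : ℂ) = Complex.exp (w (Sum.inr l) : ℂ) := fun l => rfl
  -- characters evaluate to `exp (Σ_x χ_x w_x)`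
  have hchar : ∀ χ : (Fin n ⊕ Fin n) → ℤ,
      (((∏ k, (d k) ^ (χ (Sum.inl k))) * (∏ l, (e l) ^ (χ (Sum.inr l))) : ℂˣ) : ℂ) =
        Complex.exp ((∑ x, (χ x : ℝ) * w x : ℝ) : ℂ) := by
    intro χ
    rw [Units.val_mul, units_prod_zpow_eq_exp d _ hdval, units_prod_zpow_eq_exp e _ heval, ← Complex.exp_add,
      ← Complex.ofReal_add, Fintype.sum_sum_type]
  have hchar1 : ∀ χ : (Fin n ⊕ Fin n) → ℤ,
      (∏ k, (d k) ^ (χ (Sum.inl k))) * (∏ l, (e l) ^ (χ (Sum.inr l))) = 1 ↔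
        ∃ c : Fin r → ℚ, ∀ x, (χ x : ℚ) = ∑ i, c i * (Λ i x : ℚ) := by
    intro χ
    rw [← hw χ, ← exp_ofReal_eq_one_iff, ← hchar χ, Units.val_eq_one]
  refine ⟨d, e, fun i => ?_, fun u hu hprod => ?_, fun χ hχ => ?_⟩
  · -- (i) the relations: `Λ_i` is a rational combination of the `Λ`'s
    rw [hchar1]
    refine ⟨fun j => if j = i then 1 else 0, fun x => ?_⟩
    simp only [ite_mul, one_mul, zero_mul, Finset.sum_ite_eq', mem_univ, if_true]
  · -- (ii) no non-negative relation: total row mass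
    have hval : ∏ p : Fin n × Fin n, ((d p.1 : ℂ) * (e p.2 : ℂ)) ^ u p =
        Complex.exp ((∑ p : Fin n × Fin n, (u p : ℝ) * (w (Sum.inl p.1) + w (Sum.inr p.2)) : ℝ) : ℂ) := by
      refine prod_pow_eq_exp _ _ (fun p => ?_) u
      rw [hdval, heval, ← Complex.exp_add, Complex.ofReal_add]
    set χu : (Fin n ⊕ Fin n) → ℤ :=
      Sum.elim (fun k => ∑ l, (u (k, l) : ℤ)) (fun l => ∑ k, (u (k, l) : ℤ)) with hχu
    have hmass : ∑ p : Fin n × Fin n, (u p : ℝ) * (w (Sum.inl p.1) + w (Sum.inr p.2)) =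
        ∑ x, (χu x : ℝ) * w x := by
      rw [Fintype.sum_sum_type]
      simp only [hχu, Sum.elim_inl, Sum.elim_inr, Int.cast_sum, Int.cast_natCast, Finset.sum_mul, mul_add,
        Finset.sum_add_distrib]
      congr 1
      · rw [Fintype.sum_prod_type]
      · rw [Fintype.sum_prod_type_right]
    rw [hval, hmass, exp_ofReal_eq_one_iff, hw] at hprod
    obtain ⟨c, hc⟩ := hprod
    -- row mass of `χu` is `|u| > 0`, row mass of a combination of the `Λ_i` is `0`
    have hzero : ∑ k, (χu (Sum.inl k) : ℚ) = 0 := by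
      simp only [hc]
      rw [Finset.sum_comm]
      refine Finset.sum_eq_zero fun i _ => ?_
      rw [← Finset.mul_sum]
      have : ∑ k, (Λ i (Sum.inl k) : ℚ) = 0 := by exact_mod_cast hrow i
      rw [this, mul_zero]
    have hpos : 0 < ∑ k, (χu (Sum.inl k) : ℚ) := by
      simp only [hχu, Sum.elim_inl, Int.cast_sum, Int.cast_natCast]
      rw [← Fintype.sum_prod_type (f := fun p : Fin n × Fin n => (u p : ℚ))]
      obtain ⟨p, hp⟩ : ∃ p, u p ≠ 0 := by
        by_contra h; push Not at h; exact hu (funext h)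
      have h1 : (u p : ℚ) ≤ ∑ q, (u q : ℚ) :=
        Finset.single_le_sum (fun q _ => Nat.cast_nonneg (u q)) (mem_univ p)
      have h2 : (0 : ℚ) < u p := by exact_mod_cast Nat.pos_of_ne_zero hp
      exact lt_of_lt_of_le h2 h1
    rw [hzero] at hpos
    exact lt_irrefl _ hpos
  · -- (iii) exact separation
    rw [hchar1] at hχ
    obtain ⟨c, hc⟩ := hχ
    exact exists_int_combination Λ χ c hc

end

end Summit.ValiantsHypothesis.ValiantsHypothesis.Theorems.FreeSubtorusConfusionCovering
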